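import Mathlib
import Summits.ValiantsHypothesis.ValiantsHypothesis.Theorems.DivisionGapPerCofactorDegreeReductionStubTwoTowerCollapse

/-!
# Crux `DivisionGap.PerCofactorDegreeReduction` (stmt-ValiantsHypothesis-15046), line `Sketch` —
# stub `stub_representedHalving`: represented hidden factors halve the degree

**Theorem (`stub_representedHalving`).** Let `a₁, a₂, b₁, b₂, S, T, U, V ∈ ℝ≥0[x_ij]` (`n × n`
variables) and let `s, t, u, v ∈ S_n = ℂ[x]/(per_n)` with `ā₁ = s t`, `b̄₁ = s u`, `ā₂ = u v`,
`b̄₂ = -(t v)` (the hidden rank-one shape of `stub_hiddenRankOne`).  If every hidden factor is the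
class of the corresponding nonnegative polynomial UP TO SIGN (`S̄ = ±s`, `T̄ = ±t`, `Ū = ±u`,
`V̄ = ±v`), then over `ℝ` one of: `per_n ∣ a₁ + S T`; `per_n ∣ a₂ + U V`; `per_n ∣ b₁ + S U`;
`per_n ∣ b₂ + T V` — a NONNEGATIVE member of `(per_n)` of the degree of the factors, i.e. half
the degree of the creation identity `a₁ a₂ + b₁ b₂`.

## Proof

Pure sign bookkeeping in the commutative ring `S_n` (no domain / UFD / grading, every `n`).
Write `S̄ = ε_S s`, `T̄ = ε_T t`, `Ū = ε_U u`, `V̄ = ε_V v` with signs `ε ∈ {±1}`.  Then in `S_n`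
* `a₁ + S T ↦ s t + ε_S ε_T s t`, which vanishes when `ε_S ≠ ε_T`;
* `a₂ + U V ↦ u v + ε_U ε_V u v`, which vanishes when `ε_U ≠ ε_V`;
* `b₁ + S U ↦ s u + ε_S ε_U s u`, which vanishes when `ε_S ≠ ε_U`;
* `b₂ + T V ↦ -(t v) + ε_T ε_V t v`, which vanishes when `ε_T = ε_V`.
If none of the four conditions held we would have `ε_S = ε_T`, `ε_U = ε_V`, `ε_S = ε_U` and
`ε_T ≠ ε_V`, which is absurd; so in each of the `16` sign patterns one of the four cross sums maps
to `0` in `S_n`, i.e. is divisible by `per_n` over `ℂ`, hence over `ℝ` by descent of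
divisibility for real polynomials (`TwoTowerCollapse.per_descent`).

Design: no definitions; the sixteen sign patterns are produced by `rcases` and each is closed by
the first of the four disjuncts whose image in `S_n` is a ring identity (`per_dvd_add_mul`).
Leans on Mathlib and the tree file
`Summits/…/Theorems/DivisionGapPerCofactorDegreeReductionStubTwoTowerCollapse.lean` only.
-/

noncomputable section

-- `Summit.ValiantsHypothesis.ValiantsHypothesis.…` is the tree's mandated single-conjunct layout
-- (Problem = Summit), so the duplicated namespace component is intended.
set_option linter.dupNamespace false

namespace Summit.ValiantsHypothesis.ValiantsHypothesis.Theorems.DivisionGap.PerCofactorDegreeReduction.RepresentedHalving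

open MvPolynomial Literature.Computability.AlgebraicComplexity
open Summit.ValiantsHypothesis.ValiantsHypothesis.Theorems.DivisionGap.PerCofactorDegreeReduction.TwoTowerCollapse
open scoped NNReal

/-! ### From a vanishing class in `S_n` to divisibility over `ℝ` -/

/-- **A cross sum whose class vanishes is divisible by the permanent over `ℝ`.**  For
`x, Y, Z ∈ ℝ≥0[x_ij]`: if `x̄ + Ȳ Z̄ = 0` in `S_n = ℂ[x]/(per_n)`, then `per_n ∣ x + Y Z` over `ℝ`
(the class of `x + Y Z` is `x̄ + Ȳ Z̄`, membership in `(per_n)` is divisibility over `ℂ`, which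
descends to `ℝ` by `TwoTowerCollapse.per_descent`). [folklore] -/
theorem per_dvd_add_mul {n : ℕ} (x Y Z : MvPolynomial (Fin n × Fin n) ℝ≥0)
    (h : Ideal.Quotient.mk (Ideal.span {perPoly (Fin n) ℂ})
          (MvPolynomial.map Complex.ofRealHom (MvPolynomial.map NNReal.toRealHom x)) +
        Ideal.Quotient.mk (Ideal.span {perPoly (Fin n) ℂ})
          (MvPolynomial.map Complex.ofRealHom (MvPolynomial.map NNReal.toRealHom Y)) *
        Ideal.Quotient.mk (Ideal.span {perPoly (Fin n) ℂ})
          (MvPolynomial.map Complex.ofRealHom (MvPolynomial.map NNReal.toRealHom Z)) = 0) :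
    perPoly (Fin n) ℝ ∣ MvPolynomial.map NNReal.toRealHom (x + Y * Z) := by
  refine per_descent (Ideal.mem_span_singleton.1 (Ideal.Quotient.eq_zero_iff_mem.1 ?_))
  simpa only [map_add, map_mul] using h

/-! ### The stub -/

/-- **stub_representedHalving — REPRESENTED HIDDEN FACTORS HALVE THE DEGREE.**  In the hidden
rank-one situation `ā₁ = s t`, `b̄₁ = s u`, `ā₂ = u v`, `b̄₂ = -(t v)` in `S_n = ℂ[x]/(per_n)`
(`stub_hiddenRankOne`), if each hidden factor is the class of a NONNEGATIVE polynomial up to sign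
(`S̄ = ±s`, `T̄ = ±t`, `Ū = ±u`, `V̄ = ±v`), then one of the four nonnegative cross sums
`a₁ + S T`, `a₂ + U V`, `b₁ + S U`, `b₂ + T V` is divisible by `per_n` over `ℝ`.  Sign
bookkeeping: with `S̄ = ε_S s` etc., the classes of the four sums are `(1 + ε_S ε_T) s t`,
`(1 + ε_U ε_V) u v`, `(1 + ε_S ε_U) s u`, `(ε_T ε_V - 1) t v`, and
`ε_S = ε_T`, `ε_U = ε_V`, `ε_S = ε_U`, `ε_T ≠ ε_V` cannot all hold; the vanishing class gives
divisibility over `ℂ`, which descends to `ℝ` (`per_dvd_add_mul`,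
`TwoTowerCollapse.per_descent`). [abc-tower-collapse; prime-walk-positivizer] -/
theorem stub_representedHalving (n : ℕ) (a₁ a₂ b₁ b₂ S T U V : MvPolynomial (Fin n × Fin n) ℝ≥0)
    (s t u v : MvPolynomial (Fin n × Fin n) ℂ ⧸ Ideal.span {perPoly (Fin n) ℂ})
    (ha₁ : Ideal.Quotient.mk (Ideal.span {perPoly (Fin n) ℂ})
        (MvPolynomial.map Complex.ofRealHom (MvPolynomial.map NNReal.toRealHom a₁)) = s * t)
    (hb₁ : Ideal.Quotient.mk (Ideal.span {perPoly (Fin n) ℂ})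
        (MvPolynomial.map Complex.ofRealHom (MvPolynomial.map NNReal.toRealHom b₁)) = s * u)
    (ha₂ : Ideal.Quotient.mk (Ideal.span {perPoly (Fin n) ℂ})
        (MvPolynomial.map Complex.ofRealHom (MvPolynomial.map NNReal.toRealHom a₂)) = u * v)
    (hb₂ : Ideal.Quotient.mk (Ideal.span {perPoly (Fin n) ℂ})
        (MvPolynomial.map Complex.ofRealHom (MvPolynomial.map NNReal.toRealHom b₂)) = -(t * v))
    (hS : Ideal.Quotient.mk (Ideal.span {perPoly (Fin n) ℂ})
        (MvPolynomial.map Complex.ofRealHom (MvPolynomial.map NNReal.toRealHom S)) = s ∨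
      Ideal.Quotient.mk (Ideal.span {perPoly (Fin n) ℂ})
        (MvPolynomial.map Complex.ofRealHom (MvPolynomial.map NNReal.toRealHom S)) = -s)
    (hT : Ideal.Quotient.mk (Ideal.span {perPoly (Fin n) ℂ})
        (MvPolynomial.map Complex.ofRealHom (MvPolynomial.map NNReal.toRealHom T)) = t ∨
      Ideal.Quotient.mk (Ideal.span {perPoly (Fin n) ℂ})
        (MvPolynomial.map Complex.ofRealHom (MvPolynomial.map NNReal.toRealHom T)) = -t)
    (hU : Ideal.Quotient.mk (Ideal.span {perPoly (Fin n) ℂ})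
        (MvPolynomial.map Complex.ofRealHom (MvPolynomial.map NNReal.toRealHom U)) = u ∨
      Ideal.Quotient.mk (Ideal.span {perPoly (Fin n) ℂ})
        (MvPolynomial.map Complex.ofRealHom (MvPolynomial.map NNReal.toRealHom U)) = -u)
    (hV : Ideal.Quotient.mk (Ideal.span {perPoly (Fin n) ℂ})
        (MvPolynomial.map Complex.ofRealHom (MvPolynomial.map NNReal.toRealHom V)) = v ∨
      Ideal.Quotient.mk (Ideal.span {perPoly (Fin n) ℂ})
        (MvPolynomial.map Complex.ofRealHom (MvPolynomial.map NNReal.toRealHom V)) = -v) :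
    perPoly (Fin n) ℝ ∣ MvPolynomial.map NNReal.toRealHom (a₁ + S * T) ∨
    perPoly (Fin n) ℝ ∣ MvPolynomial.map NNReal.toRealHom (a₂ + U * V) ∨
    perPoly (Fin n) ℝ ∣ MvPolynomial.map NNReal.toRealHom (b₁ + S * U) ∨
    perPoly (Fin n) ℝ ∣ MvPolynomial.map NNReal.toRealHom (b₂ + T * V) := by
  -- sixteen sign patterns; in each, the first cross sum whose class is a ring identity `= 0`
  rcases hS with hS | hS <;> rcases hT with hT | hT <;> rcases hU with hU | hU <;>
    rcases hV with hV | hV <;>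
    first
    | exact Or.inl (per_dvd_add_mul _ _ _ (by rw [ha₁, hS, hT]; ring1))
    | exact Or.inr (Or.inl (per_dvd_add_mul _ _ _ (by rw [ha₂, hU, hV]; ring1)))
    | exact Or.inr (Or.inr (Or.inl (per_dvd_add_mul _ _ _ (by rw [hb₁, hS, hU]; ring1))))
    | exact Or.inr (Or.inr (Or.inr (per_dvd_add_mul _ _ _ (by rw [hb₂, hT, hV]; ring1))))

end Summit.ValiantsHypothesis.ValiantsHypothesis.Theorems.DivisionGap.PerCofactorDegreeReduction.RepresentedHalving
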